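import Summits.SmoothPoincare4.SmoothPoincare4.Theses.SullivanDual
import Literature.Geometry.Symplectic.TamingWitness
import Literature.Geometry.Symplectic.JHolomorphicMap
import Literature.Geometry.Kaehler.ManifoldFormsChart
import Summits.SmoothPoincare4.SmoothPoincare4.Theorems.SullivanDualWitnessChargeStubWitnessClosed
import Summits.SmoothPoincare4.SmoothPoincare4.Theorems.SullivanDualWitnessChargeStubPencilExactTaming
import Summits.SmoothPoincare4.SmoothPoincare4.Theorems.SullivanDualWitnessChargeStubTamingFormExists
import Summits.SmoothPoincare4.SmoothPoincare4.Theorems.SullivanDualWitnessChargeStubBubbleConfinement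
import Summits.SmoothPoincare4.SmoothPoincare4.Theorems.SullivanDualWitnessChargeStubCollar

/-!
# REDUCTION of crux `WitnessCharge` (stmt-SmoothPoincare4-7824, route `SullivanDual`) to the hard stub
`stub_pencilOrRescale` of line `Sketch` (= idea `pencil-incompleteness`); registered sub-goal
`WitnessCharge_of_pencilOrRescale`

`WitnessCharge_of_pencilOrRescale : PencilOrRescale → Theses.SullivanDual.WitnessCharge`, where the
hypothesis `PencilOrRescale` (written out verbatim as `hPR`; it is the registered stub
`stub_pencilOrRescale` of the skeleton `Cruxes/WitnessCharge/Lines/Sketch.lean`) says: under the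
standing hypotheses of the crux, EITHER Gromov's pencil of `J`-planes at the flat end is complete
(a diffeomorphism `F : ℂ × ℂ ≃ₘ Σ∖p` conjugating `J` to a continuous `Ĵ` with holomorphic slices and
positively oriented transverse part) OR there is an entire `J`-curve staying away from `p`.
Everything else of the line has LANDED and is imported: STEP 0 (`stub_tamingFormExists`,
`stub_collar`, `stub_witnessClosed`: a taming witness kills every exact smooth 2-form),
`stub_pencilExactTaming` (a complete pencil yields an exact form taming `J` off `B_ε`) and
`stub_bubbleConfinement` (an entire `J`-curve staying away from `p` avoids the standard collar).
So the crux `WitnessCharge` is CLOSED MODULO `stub_pencilOrRescale` (Gromov pencil without taming +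
Zalcman–Brody rescaling; research-level; referee-level proof and formalisation plan in
`Cruxes/WitnessCharge/Lines/Sketch.md` and `Cruxes/WitnessCharge/NOTES.md`).
-/

noncomputable section

set_option linter.dupNamespace false

open scoped Manifold ContDiff Topology
open Set Filter Literature.Geometry.Kaehler Literature.Geometry.Symplectic
  Literature.Topology.FourManifolds

namespace Summit.SmoothPoincare4.SmoothPoincare4.Theorems.WitnessCharge.PencilIncompleteness

-- `stub_tamingFormExists` LANDED: Theorems/SullivanDualWitnessChargeStubTamingFormExists.lean (p105660); same namespace and name, imported above.

-- `stub_collar` LANDED: Theorems/SullivanDualWitnessChargeStubCollar.lean (p111266); same namespace and name, imported above.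

-- STEP 0(c) `stub_witnessClosed` LANDED: Theorems/SullivanDualWitnessChargeStubWitnessClosed.lean (p102093),
-- same namespace and name; imported above.

-- `stub_pencilExactTaming` LANDED: Theorems/SullivanDualWitnessChargeStubPencilExactTaming.lean (p104134); same namespace and name, imported above.


-- `stub_bubbleConfinement` LANDED: Theorems/SullivanDualWitnessChargeStubBubbleConfinement.lean (p111336); same namespace and name, imported above.

/-- **PENCIL ALTERNATIVE under the hypothesis `hPR` (= stub `stub_pencilOrRescale`)**: either the
complete-pencil data exist or there is an entire `J`-curve avoiding `B_ε` (a rescaling limit staying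
away from `p` avoids `B_{ε'} ⊇ B_ε` by the landed `stub_bubbleConfinement`). -/
theorem pencilAlternative_of
    (hPR :
    ∀ (S : HomotopySphere 4) (p : S.carrier)
      (J : ∀ x : punctured p, TangentSpace (𝓡 4) x →L[ℝ] TangentSpace (𝓡 4) x) (ε ε' : ℝ),
      0 < ε → ε < ε' →
      Metric.closedBall (extChartAt (𝓡 4) p p) ε' ⊆ (extChartAt (𝓡 4) p).target →
      (∀ (x : punctured p) (v : TangentSpace (𝓡 4) x), J x (J x v) = -v) →
      (∀ x₀ : punctured p, ContMDiffAt (𝓡 4) 𝓘(ℝ, EuclideanSpace ℝ (Fin 4) →L[ℝ] EuclideanSpace ℝ (Fin 4)) ∞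
        (inTangentCoordinates (𝓡 4) (𝓡 4) (id : punctured p → punctured p) id (fun x => J x) x₀) x₀) →
      (∀ x : punctured p, InPuncturedChartBall p ε' x →
        ∀ (v : TangentSpace (𝓡 4) x) (b : EuclideanSpace ℝ (Fin 4)),
          inner ℝ (fderiv ℝ inversion (extChartAt (𝓡 4) p x.1 - extChartAt (𝓡 4) p p)
            (mfderiv (𝓡 4) 𝓘(ℝ, EuclideanSpace ℝ (Fin 4))
              (fun z : punctured p => extChartAt (𝓡 4) p z.1) x (J x v))) b
          = stdSymplecticForm (fderiv ℝ inversion (extChartAt (𝓡 4) p x.1 - extChartAt (𝓡 4) p p)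
            (mfderiv (𝓡 4) 𝓘(ℝ, EuclideanSpace ℝ (Fin 4))
              (fun z : punctured p => extChartAt (𝓡 4) p z.1) x v)) b) →
      (∃ (F : (ℂ × ℂ) ≃ₘ⟮𝓘(ℝ, ℂ × ℂ), 𝓡 4⟯ (punctured p))
          (Jhat : ℂ × ℂ → (ℂ × ℂ →L[ℝ] ℂ × ℂ)), Continuous Jhat ∧
        (∀ (q : ℂ × ℂ) (u : ℂ × ℂ),
          mfderiv 𝓘(ℝ, ℂ × ℂ) (𝓡 4) F q (Jhat q u) = J (F q) (mfderiv 𝓘(ℝ, ℂ × ℂ) (𝓡 4) F q u)) ∧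
        (∀ (q : ℂ × ℂ) (ζ : ℂ), Jhat q (0, ζ) = (0, Complex.I * ζ)) ∧
        (∀ (q : ℂ × ℂ) (w : ℂ), w ≠ 0 →
          0 < w.re * ((Jhat q (w, 0)).1).im - w.im * ((Jhat q (w, 0)).1).re)) ∨
      (∃ u : ℂ → punctured p, IsEntireJCurve (𝓡 4) J u ∧
        ∃ η : ℝ, 0 < η ∧ ∀ z : ℂ, ¬ InPuncturedChartBall p η (u z))) :
    ∀ (S : HomotopySphere 4) (p : S.carrier)
      (J : ∀ x : punctured p, TangentSpace (𝓡 4) x →L[ℝ] TangentSpace (𝓡 4) x) (ε ε' : ℝ),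
      0 < ε → ε < ε' →
      Metric.closedBall (extChartAt (𝓡 4) p p) ε' ⊆ (extChartAt (𝓡 4) p).target →
      (∀ (x : punctured p) (v : TangentSpace (𝓡 4) x), J x (J x v) = -v) →
      (∀ x₀ : punctured p, ContMDiffAt (𝓡 4) 𝓘(ℝ, EuclideanSpace ℝ (Fin 4) →L[ℝ] EuclideanSpace ℝ (Fin 4)) ∞
        (inTangentCoordinates (𝓡 4) (𝓡 4) (id : punctured p → punctured p) id (fun x => J x) x₀) x₀) →
      (∀ x : punctured p, InPuncturedChartBall p ε' x →
        ∀ (v : TangentSpace (𝓡 4) x) (b : EuclideanSpace ℝ (Fin 4)),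
          inner ℝ (fderiv ℝ inversion (extChartAt (𝓡 4) p x.1 - extChartAt (𝓡 4) p p)
            (mfderiv (𝓡 4) 𝓘(ℝ, EuclideanSpace ℝ (Fin 4))
              (fun z : punctured p => extChartAt (𝓡 4) p z.1) x (J x v))) b
          = stdSymplecticForm (fderiv ℝ inversion (extChartAt (𝓡 4) p x.1 - extChartAt (𝓡 4) p p)
            (mfderiv (𝓡 4) 𝓘(ℝ, EuclideanSpace ℝ (Fin 4))
              (fun z : punctured p => extChartAt (𝓡 4) p z.1) x v)) b) →
      (∃ (F : (ℂ × ℂ) ≃ₘ⟮𝓘(ℝ, ℂ × ℂ), 𝓡 4⟯ (punctured p))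
          (Jhat : ℂ × ℂ → (ℂ × ℂ →L[ℝ] ℂ × ℂ)), Continuous Jhat ∧
        (∀ (q : ℂ × ℂ) (u : ℂ × ℂ),
          mfderiv 𝓘(ℝ, ℂ × ℂ) (𝓡 4) F q (Jhat q u) = J (F q) (mfderiv 𝓘(ℝ, ℂ × ℂ) (𝓡 4) F q u)) ∧
        (∀ (q : ℂ × ℂ) (ζ : ℂ), Jhat q (0, ζ) = (0, Complex.I * ζ)) ∧
        (∀ (q : ℂ × ℂ) (w : ℂ), w ≠ 0 →
          0 < w.re * ((Jhat q (w, 0)).1).im - w.im * ((Jhat q (w, 0)).1).re)) ∨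
      (∃ u : ℂ → punctured p, IsEntireJCurve (𝓡 4) J u ∧
        ∀ z : ℂ, ¬ InPuncturedChartBall p ε (u z)) := by
  intro S p J ε ε' hε hεε' hball hJ2 hJs hJstd
  rcases hPR S p J ε ε' hε hεε' hball hJ2 hJs hJstd with hF | ⟨u, hu, hη⟩
  · exact Or.inl hF
  · refine Or.inr ⟨u, hu, fun z hz => ?_⟩
    exact stub_bubbleConfinement S p J ε' (hε.trans hεε') hball hJstd u hu.1 hu.2.1 hu.2.2 hη z
      (hz.mono hεε'.le)

/-- **The crux `WitnessCharge` modulo the hard stub.** Given `hPR` (= `stub_pencilOrRescale`):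
witness `T` ⇒ (`pencilAlternative_of hPR`) entire curve avoiding `B_ε` — done — or complete pencil;
then the landed `stub_pencilExactTaming` gives an exact smooth `dη` taming `J` off `B_ε`, so (W1)
`0 < T (dη)`, while the landed STEP 0 (`stub_tamingFormExists` + `stub_collar` +
`stub_witnessClosed`) gives `T (dη) = 0`. -/
theorem WitnessCharge_of_pencilOrRescale
    (hPR :
    ∀ (S : HomotopySphere 4) (p : S.carrier)
      (J : ∀ x : punctured p, TangentSpace (𝓡 4) x →L[ℝ] TangentSpace (𝓡 4) x) (ε ε' : ℝ),
      0 < ε → ε < ε' →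
      Metric.closedBall (extChartAt (𝓡 4) p p) ε' ⊆ (extChartAt (𝓡 4) p).target →
      (∀ (x : punctured p) (v : TangentSpace (𝓡 4) x), J x (J x v) = -v) →
      (∀ x₀ : punctured p, ContMDiffAt (𝓡 4) 𝓘(ℝ, EuclideanSpace ℝ (Fin 4) →L[ℝ] EuclideanSpace ℝ (Fin 4)) ∞
        (inTangentCoordinates (𝓡 4) (𝓡 4) (id : punctured p → punctured p) id (fun x => J x) x₀) x₀) →
      (∀ x : punctured p, InPuncturedChartBall p ε' x →
        ∀ (v : TangentSpace (𝓡 4) x) (b : EuclideanSpace ℝ (Fin 4)),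
          inner ℝ (fderiv ℝ inversion (extChartAt (𝓡 4) p x.1 - extChartAt (𝓡 4) p p)
            (mfderiv (𝓡 4) 𝓘(ℝ, EuclideanSpace ℝ (Fin 4))
              (fun z : punctured p => extChartAt (𝓡 4) p z.1) x (J x v))) b
          = stdSymplecticForm (fderiv ℝ inversion (extChartAt (𝓡 4) p x.1 - extChartAt (𝓡 4) p p)
            (mfderiv (𝓡 4) 𝓘(ℝ, EuclideanSpace ℝ (Fin 4))
              (fun z : punctured p => extChartAt (𝓡 4) p z.1) x v)) b) →
      (∃ (F : (ℂ × ℂ) ≃ₘ⟮𝓘(ℝ, ℂ × ℂ), 𝓡 4⟯ (punctured p))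
          (Jhat : ℂ × ℂ → (ℂ × ℂ →L[ℝ] ℂ × ℂ)), Continuous Jhat ∧
        (∀ (q : ℂ × ℂ) (u : ℂ × ℂ),
          mfderiv 𝓘(ℝ, ℂ × ℂ) (𝓡 4) F q (Jhat q u) = J (F q) (mfderiv 𝓘(ℝ, ℂ × ℂ) (𝓡 4) F q u)) ∧
        (∀ (q : ℂ × ℂ) (ζ : ℂ), Jhat q (0, ζ) = (0, Complex.I * ζ)) ∧
        (∀ (q : ℂ × ℂ) (w : ℂ), w ≠ 0 →
          0 < w.re * ((Jhat q (w, 0)).1).im - w.im * ((Jhat q (w, 0)).1).re)) ∨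
      (∃ u : ℂ → punctured p, IsEntireJCurve (𝓡 4) J u ∧
        ∃ η : ℝ, 0 < η ∧ ∀ z : ℂ, ¬ InPuncturedChartBall p η (u z))) :
    Theses.SullivanDual.WitnessCharge := by
  intro S p J ε ε' hε hεε' hball hJ2 hJs hJstd hT
  obtain ⟨T, hT⟩ := hT
  rcases pencilAlternative_of hPR S p J ε ε' hε hεε' hball hJ2 hJs hJstd with
    ⟨F, Jhat, hJc, hconj, hslice, horient⟩ | ⟨u, hu, hav⟩
  · -- complete pencil: exact taming form `dη` versus the closed witness
    exfalso
    obtain ⟨η, hηs, hηt⟩ :=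
      stub_pencilExactTaming S p J ε hε hJ2 hJs F Jhat hJc hconj hslice horient
    have hW : TamingWitness p ε J T := hT
    have hdηs : IsSmoothForm (mextDeriv η) :=
      isSmoothForm_mextDeriv (inChart_mextDeriv_holds _ _ _) hηs
    have hpos : 0 < T (mextDeriv η) := hW.pos_of_tames hdηs hηt
    obtain ⟨β, hβs, hβt⟩ := stub_tamingFormExists S p J hJ2 hJs
    have hcollar := stub_collar S p J ε ε' hε hεε' hball hJstd β hβs hβt T hW
    have hzero : T (mextDeriv η) = 0 :=
      stub_witnessClosed S p J ε ε' hε hεε' hball T hW hcollar η hηs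
    exact absurd hzero hpos.ne'
  · exact ⟨u, hu.1, hu.2.1, hu.2.2, hav⟩

end Summit.SmoothPoincare4.SmoothPoincare4.Theorems.WitnessCharge.PencilIncompleteness
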